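import Summits.Ventures.QEC.Census.CertCheckBZMitm
import Summits.Ventures.QEC.Census.CertMitmLemmas
import Summits.Ventures.QEC.Census.CertSystematicWeight
import HarnessLib

/-!
# Soundness of the layers of the meet-in-the-middle replay of a Brouwer–Zimmermann matrix
# (per-layer facts for qec-search-9's `henum_of_mitm`; P1 (β), director-qec R15 (4))

`Census/CertCheckBZMitm.lean` (qec-search-9) replays the claim "every XOR of `w ≤ t` rows of the systematic matrix
`G` (on the information set `T`) of weight `≤ W` is allow-listed" layer by layer: `w = 1, 2` directly
(`mitmDirectOK`), `w = 3` directly (`direct3OK`), and `w = 4, 5` by an exact collision on one of `W + 1 − w`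
pairwise-disjoint groups of redundancy columns (`mitmLayerOK … w g`: pair tables keyed by the group, self-lookup
`t1OK`, probes `probesOK`). This file PROVES, against those definitions and with no new definition, the semantic
content of each Boolean check:

* completeness of the enumerations: every pair `i < j` of rows occurs in `pairXT (idxRows G k)` with word
  `G[i] ⊕ G[j]` (`mem_pairXT_idxRows`); `direct3OK`, `probe5OK`, `probesOK … 4` reach every triple / (row, later pair)
  / pair (`mitmLeaf_of_direct3OK`, `probeOK_of_probe5OK`, `probeOK_of_probesOK_four`); `t1OK` finds every listed pair
  in the tables with the right decoded index and pair word (`exists_tabFind_of_t1OK`); `probeOK` tests every table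
  hit with a smaller recorded index (`mitmLeaf_of_probeOK`); `groupsOK` gives the three mask properties
  (`groupsOK_spec`); the leaf test on a light word means allow-listed (`allow_of_mitmLeaf`);
* the layer theorems `allow_of_mitmLayerOK_four` / `allow_of_mitmLayerOK_five`: if `G` is systematic on `T`
  (`systematicOK`), words `< 2^n ≤ 2^{8B}`, `B ≤ 31`, the groups of layer `w` pass `groupsOK` and every group's
  `mitmLayerOK … w g` passes, then every XOR of `w` rows with increasing indices and weight `≤ W` is allow-listed.
  Chain: systematic weight identity (`popc_eq_length_add_popc_and_red`, type-01) ⇒ redundancy weight `≤ W − w <`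
  number of groups ⇒ pigeonhole over the disjoint group masks (`exists_lt_and_mask_eq_zero`, `CertMitmLemmas.lean`)
  ⇒ the table half and the probe half agree on that group (`and_eq_and_of_xor_and_eq_zero`) ⇒ equal keys ⇒ the
  probe meets the table pair (smaller recorded index) and tests exactly the XOR of the `w` rows;
* `allow_of_direct3OK` (layer 3) and `allow_of_mitmDirectOK_one/two` (layers 1, 2).

The assembly over selections `a : Fin kb → 𝔽₂` (sorted support lists) and over the parts of `mitmPart` is
qec-search-9's `henum_of_mitm` / `block_sound_mitm`; nothing here mentions a distance. Tier KERNEL (axioms standard).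
-/

namespace Summit.Ventures.QEC.Census

open Finset

/-! ## Completeness of the enumerations -/

/-- Rows keep their values: `(k + j, G[j]) ∈ idxRows G k`. -/
theorem mem_idxRows (G : List ℕ) (k : ℕ) {j : ℕ} (hj : j < G.length) : (k + j, G[j]) ∈ idxRows G k := by
  induction G generalizing k j with
  | nil => simp at hj
  | cons g gs ih =>
    rw [idxRows]
    rcases j with _ | j
    · simp
    · have hj' : j < gs.length := by simpa using hj
      have := ih (k + 1) hj'
      rw [show k + 1 + j = k + (j + 1) by omega] at this
      exact List.mem_cons_of_mem _ (by simpa using this)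

/-- Indices recorded by `idxRows G k` are `≥ k`. -/
theorem le_of_mem_idxRows {G : List ℕ} {k : ℕ} {r : ℕ × ℕ} (hr : r ∈ idxRows G k) : k ≤ r.1 := by
  induction G generalizing k with
  | nil => simp [idxRows] at hr
  | cons g gs ih =>
    rw [idxRows, List.mem_cons] at hr
    rcases hr with rfl | hr
    · exact le_rfl
    · exact (Nat.le_succ k).trans (ih hr)

/-- **Every pair occurs**: for `i < j < |G|`, `(k+i, k+j, G[i] ⊕ G[j]) ∈ pairXT (idxRows G k)`. -/
theorem mem_pairXT_idxRows (G : List ℕ) (k : ℕ) {i j : ℕ} (hij : i < j) (hj : j < G.length) :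
    (k + i, k + j, G[i]'(hij.trans hj) ^^^ G[j]) ∈ pairXT (idxRows G k) := by
  induction G generalizing k i j with
  | nil => simp at hj
  | cons g gs ih =>
    rw [idxRows, pairXT, List.mem_append]
    rcases i with _ | i
    · -- the head row against row `j ≥ 1` of the tail
      left
      rcases j with _ | j
      · omega
      · have hj' : j < gs.length := by simpa using hj
        refine List.mem_map.2 ⟨(k + 1 + j, gs[j]), mem_idxRows gs (k + 1) hj', ?_⟩
        simp only [List.getElem_cons_zero, List.getElem_cons_succ, Nat.add_zero]
        refine Prod.ext rfl (Prod.ext (by simp; omega) rfl)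
    · right
      rcases j with _ | j
      · omega
      · have hj' : j < gs.length := by simpa using hj
        have := ih (k + 1) (i := i) (j := j) (by omega) hj'
        simp only [List.getElem_cons_succ]
        rw [show k + (i + 1) = k + 1 + i by omega, show k + (j + 1) = k + 1 + j by omega]
        exact this

/-- **Layer 3 reaches every triple**: `direct3OK` on `idxRows G k` tests `G[i] ⊕ (G[j] ⊕ G[l])` for all
`i < j < l`. -/
theorem mitmLeaf_of_direct3OK {B W : ℕ} {allow : List ℕ} (G : List ℕ) (k : ℕ)
    (h : direct3OK B W allow (idxRows G k) = true) {i j l : ℕ} (hij : i < j) (hjl : j < l) (hl : l < G.length) :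
    mitmLeaf B W allow (G[i]'(hij.trans (hjl.trans hl)) ^^^ (G[j]'(hjl.trans hl) ^^^ G[l])) = true := by
  induction G generalizing k i j l with
  | nil => simp at hl
  | cons g gs ih =>
    rw [idxRows, direct3OK, Bool.and_eq_true, List.all_eq_true] at h
    rcases i with _ | i
    · rcases j with _ | j
      · omega
      rcases l with _ | l
      · omega
      have hl' : l < gs.length := by simpa using hl
      have hmem := mem_pairXT_idxRows gs (k + 1) (i := j) (j := l) (by omega) hl'
      have := h.1 _ hmem
      simpa using this
    · rcases j with _ | j
      · omega
      rcases l with _ | l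
      · omega
      have hl' : l < gs.length := by simpa using hl
      have := ih (k + 1) h.2 (i := i) (j := j) (l := l) (by omega) (by omega) hl'
      simpa using this

/-- **Layer 5 probes reach every (row, later pair)**: `probe5OK` on `idxRows G k` runs
`probeOK … (k+i) (G[i] ⊕ (G[j] ⊕ G[l]))` for all `i < j < l`. -/
theorem probeOK_of_probe5OK {B W : ℕ} {allow : List ℕ} {A n : ℕ} {tp : List ℕ × ℕ} (G : List ℕ) (k : ℕ)
    (h : probe5OK B W allow A n tp (idxRows G k) = true) {i j l : ℕ} (hij : i < j) (hjl : j < l)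
    (hl : l < G.length) :
    probeOK B W allow A n tp (k + i) (G[i]'(hij.trans (hjl.trans hl)) ^^^ (G[j]'(hjl.trans hl) ^^^ G[l])) = true := by
  induction G generalizing k i j l with
  | nil => simp at hl
  | cons g gs ih =>
    rw [idxRows, probe5OK, Bool.and_eq_true, List.all_eq_true] at h
    rcases i with _ | i
    · rcases j with _ | j
      · omega
      rcases l with _ | l
      · omega
      have hl' : l < gs.length := by simpa using hl
      have hmem := mem_pairXT_idxRows gs (k + 1) (i := j) (j := l) (by omega) hl'
      have := h.1 _ hmem
      simpa using this
    · rcases j with _ | j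
      · omega
      rcases l with _ | l
      · omega
      have hl' : l < gs.length := by simpa using hl
      have := ih (k + 1) h.2 (i := i) (j := j) (l := l) (by omega) (by omega) hl'
      simpa [show k + 1 + i = k + (i + 1) by omega] using this

/-- **Layer 4 probes reach every pair**: `probesOK … rows 4` on `idxRows G k` runs `probeOK … (k+i) (G[i] ⊕ G[j])`
for all `i < j`. -/
theorem probeOK_of_probesOK_four {B W : ℕ} {allow : List ℕ} {A n : ℕ} {tp : List ℕ × ℕ} (G : List ℕ) (k : ℕ)
    (h : probesOK B W allow A n tp (idxRows G k) 4 = true) {i j : ℕ} (hij : i < j) (hj : j < G.length) :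
    probeOK B W allow A n tp (k + i) (G[i]'(hij.trans hj) ^^^ G[j]) = true := by
  rw [probesOK, if_pos rfl, List.all_eq_true] at h
  exact h _ (mem_pairXT_idxRows G k hij hj)

/-- `probesOK … 5` is `probe5OK`. -/
theorem probe5OK_of_probesOK_five {B W : ℕ} {allow : List ℕ} {A n : ℕ} {tp : List ℕ × ℕ} {rows : List (ℕ × ℕ)}
    (h : probesOK B W allow A n tp rows 5 = true) : probe5OK B W allow A n tp rows = true := by
  rw [probesOK, if_neg (by norm_num), if_pos rfl] at h
  exact h

/-- **Self-lookup (T1)**: if `t1OK A n tp ps p₀` passes then every listed pair `(i, j, x) ∈ ps` is found — some slot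
value `v` at the key of `x` has recorded index `decJ v = j` and pair word `pairX n tp.2 (decP v) = x`. -/
theorem exists_tabFind_of_t1OK {A n : ℕ} {tp : List ℕ × ℕ} (ps : List (ℕ × ℕ × ℕ)) (p₀ : ℕ)
    (h : t1OK A n tp ps p₀ = true) {e : ℕ × ℕ × ℕ} (he : e ∈ ps) :
    ∃ v ∈ tabFind (gkey A e.2.2) tp.1, decJ v = e.2.1 ∧ pairX n tp.2 (decP v) = e.2.2 := by
  induction ps generalizing p₀ with
  | nil => simp at he
  | cons e' es ih =>
    rw [t1OK] at h
    simp only [Bool.and_eq_true, List.any_eq_true] at h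
    obtain ⟨⟨⟨⟨hx, hj⟩, hp⟩, v, hv, hve⟩, hrest⟩ := h
    rcases List.mem_cons.1 he with rfl | he
    · have hve' : encE e.2.1 p₀ = v := Nat.eq_of_beq_eq_true hve
      refine ⟨v, hv, ?_, ?_⟩
      · rw [← hve']; exact Nat.eq_of_beq_eq_true hj
      · rw [← hve', Nat.eq_of_beq_eq_true hp]; exact Nat.eq_of_beq_eq_true hx
    · exact ih (p₀ + 1) hrest he

/-- **A probe tests every table hit with a smaller recorded index**: if `probeOK … m x` passes, `v` is a slot value
at the key of `x` and `decJ v < m`, then the leaf test passes on `pairX n tp.2 (decP v) ⊕ x`. -/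
theorem mitmLeaf_of_probeOK {B W : ℕ} {allow : List ℕ} {A n : ℕ} {tp : List ℕ × ℕ} {m x : ℕ}
    (h : probeOK B W allow A n tp m x = true) {v : ℕ} (hv : v ∈ tabFind (gkey A x) tp.1) (hvm : decJ v < m) :
    mitmLeaf B W allow (pairX n tp.2 (decP v) ^^^ x) = true := by
  rw [probeOK, List.all_eq_true] at h
  have := h v hv
  rw [Bool.or_eq_true] at this
  rcases this with hle | hleaf
  · rw [Nat.ble_eq] at hle; omega
  · exact hleaf

/-- **The checked group conditions**: `groupsOK n T s` gives, for the masks `A g = groupMask n T s g`, `g < s`: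
avoidance of the information set (`A g &&& maskOf T = 0`), range (`A g < 2^n`) and pairwise disjointness. -/
theorem groupsOK_spec {n : ℕ} {T : List ℕ} {s : ℕ} (h : groupsOK n T s = true) :
    (∀ g, g < s → groupMask n T s g &&& maskOf T = 0) ∧ (∀ g, g < s → groupMask n T s g < 2 ^ n) ∧
      (∀ g g', g < s → g' < s → g ≠ g' → groupMask n T s g &&& groupMask n T s g' = 0) := by
  simp only [groupsOK, List.all_eq_true, List.mem_range, Bool.and_eq_true, beq_iff_eq, decide_eq_true_eq,
    Bool.or_eq_true] at h
  refine ⟨fun g hg => (h g hg).1.1, fun g hg => (h g hg).1.2, fun g g' hg hg' hne => ?_⟩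
  rcases (h g hg).2 g' hg' with h' | h'
  · exact absurd h' hne
  · exact h'

/-- Bit counts do not see zero high bits: for `c < 2^n` and `n ≤ m`, `popc m c = popc n c`. -/
theorem popc_eq_popc_of_lt {n m c : ℕ} (hnm : n ≤ m) (hc : c < 2 ^ n) : popc m c = popc n c := by
  induction n generalizing m c with
  | zero =>
    have : c = 0 := by simpa using hc
    subst this
    rw [popc_zero, popc_zero]
  | succ n ih =>
    obtain ⟨m, rfl⟩ : ∃ m', m = m' + 1 := ⟨m - 1, by omega⟩
    rw [popc, popc, ih (by omega) (by rw [Nat.pow_succ] at hc; omega)]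

/-- **The leaf test on a light word means allow-listed**: if `c < 2^n`, `n ≤ 8B`, `B ≤ 31`, `popc n c ≤ W` and
`mitmLeaf B W allow c` passes, then `c` is allow-listed. -/
theorem allow_of_mitmLeaf {B W n : ℕ} {allow : List ℕ} {c : ℕ} (hB : B ≤ 31) (hn : n ≤ 8 * B) (hc : c < 2 ^ n)
    (hw : popc n c ≤ W) (h : mitmLeaf B W allow c = true) : allow.any (Nat.beq c) = true := by
  rw [mitmLeaf, Bool.or_eq_true] at h
  rcases h with hlt | ha
  · have hc' : c < 2 ^ (8 * B) := lt_of_lt_of_le hc (Nat.pow_le_pow_right (by norm_num) hn)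
    rw [popcFold_eq_popc hB hc', popc_eq_popc_of_lt hn hc, Nat.blt_eq] at hlt
    omega
  · exact ha

/-- Equal restrictions give equal keys. -/
theorem gkey_eq_of_and_eq {A a b : ℕ} (h : a &&& A = b &&& A) : gkey A a = gkey A b := by
  unfold gkey; rw [h]

/-! ## The layer theorems -/

section Layers

variable {n B W : ℕ} {allow G T : List ℕ}

/-- The XOR of rows with listed indices, as `xorList` over `getD` (the shape of `popc_eq_length_add_popc_and_red`). -/
private theorem xorList_map_getD_four {i j k l : ℕ} (hl : l < G.length) (hi : i < G.length) (hj : j < G.length)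
    (hk : k < G.length) :
    xorList ([i, j, k, l].map fun q => G.getD q 0) = G[i] ^^^ G[j] ^^^ (G[k] ^^^ G[l]) := by
  simp only [List.map_cons, List.map_nil, xorList, List.getD_eq_getElem _ _ hi, List.getD_eq_getElem _ _ hj,
    List.getD_eq_getElem _ _ hk, List.getD_eq_getElem _ _ hl, Nat.xor_zero]
  rw [Nat.xor_assoc]

/-- The XOR of five rows with listed indices, as `xorList` over `getD`. -/
private theorem xorList_map_getD_five {i j k l m : ℕ} (hi : i < G.length) (hj : j < G.length) (hk : k < G.length)
    (hl : l < G.length) (hm : m < G.length) :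
    xorList ([i, j, k, l, m].map fun q => G.getD q 0) = G[i] ^^^ G[j] ^^^ (G[k] ^^^ (G[l] ^^^ G[m])) := by
  simp only [List.map_cons, List.map_nil, xorList, List.getD_eq_getElem _ _ hi, List.getD_eq_getElem _ _ hj,
    List.getD_eq_getElem _ _ hk, List.getD_eq_getElem _ _ hl, List.getD_eq_getElem _ _ hm, Nat.xor_zero]
  rw [Nat.xor_assoc]

/-- The redundancy weight of an XOR of `w` distinct rows of a systematic matrix is its weight minus `w`; in
particular an XOR of `w` rows of weight `≤ W` has redundancy weight `≤ W − w`, i.e. `< W + 1 − w`. -/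
theorem popc_red_lt_of_popc_le (hsys : systematicOK n G T = true) (hG : ∀ g ∈ G, g < 2 ^ n) (J : List ℕ)
    (hJ : J.Nodup) (hJlt : ∀ j ∈ J, j < G.length) (hw : popc n (xorList (J.map fun q => G.getD q 0)) ≤ W) :
    popc n (xorList (J.map fun q => G.getD q 0) &&& ((2 ^ n - 1) ^^^ maskOf T)) < W + 1 - J.length := by
  have := popc_eq_length_add_popc_and_red n G T hsys hG J hJ hJlt
  omega

/-- **Layer 4 is sound.** If `G` is systematic on `T` with words `< 2^n`, `n ≤ 8B`, `B ≤ 31`, the `W − 3` groups of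
layer 4 pass `groupsOK`, and `mitmLayerOK … 4 g` passes for every group `g`, then for all rows `i < j < k < l` whose
XOR `c` has `popc n c ≤ W`, `c` is allow-listed. (Pigeonhole on the redundancy bits of `c` gives a group on which
`G[i] ⊕ G[j]` and `G[k] ⊕ G[l]` agree; the table pair `(i,j)` sits at that key with recorded index `j < k`, so the
probe of `(k,l)` tests exactly `c`.) -/
theorem allow_of_mitmLayerOK_four (hsys : systematicOK n G T = true) (hG : ∀ g ∈ G, g < 2 ^ n) (hB : B ≤ 31)
    (hn : n ≤ 8 * B) (hgrp : groupsOK n T (W + 1 - 4) = true)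
    (hlay : ∀ g, g < W + 1 - 4 → mitmLayerOK n B W allow G T 4 g = true) {i j k l : ℕ} (hij : i < j)
    (hjk : j < k) (hkl : k < l) (hl : l < G.length)
    (hw : popc n (G[i]'(by omega) ^^^ G[j]'(by omega) ^^^ (G[k]'(by omega) ^^^ G[l])) ≤ W) :
    allow.any (Nat.beq (G[i]'(by omega) ^^^ G[j]'(by omega) ^^^ (G[k]'(by omega) ^^^ G[l]))) = true := by
  have hi : i < G.length := by omega
  have hj : j < G.length := by omega
  have hk : k < G.length := by omega
  set a : ℕ := G[i] ^^^ G[j] with ha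
  set b : ℕ := G[k] ^^^ G[l] with hb
  -- the word is below `2^n`
  have hGi : ∀ {q : ℕ} (hq : q < G.length), G[q] < 2 ^ n := fun hq => hG _ (List.getElem_mem hq)
  have hc : a ^^^ b < 2 ^ n := Nat.xor_lt_two_pow (Nat.xor_lt_two_pow (hGi hi) (hGi hj)) (Nat.xor_lt_two_pow (hGi hk) (hGi hl))
  -- redundancy weight `< W − 3` (systematic weight identity)
  have hred : popc n ((a ^^^ b) &&& ((2 ^ n - 1) ^^^ maskOf T)) < W + 1 - 4 := by
    have := popc_red_lt_of_popc_le (W := W) hsys hG [i, j, k, l]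
      (by simp; omega) (by simp; omega) (by rw [xorList_map_getD_four hl hi hj hk]; exact hw)
    rw [xorList_map_getD_four hl hi hj hk] at this
    simpa using this
  -- pigeonhole over the disjoint groups
  obtain ⟨hAM, hAn, hdisj⟩ := groupsOK_spec hgrp
  obtain ⟨g, hg, hzero⟩ := exists_lt_and_mask_eq_zero n (W + 1 - 4) (a ^^^ b) (maskOf T)
    (groupMask n T (W + 1 - 4)) hAM hAn hdisj hred
  -- equal keys on group `g`
  have hkey : gkey (groupMask n T (W + 1 - 4) g) a = gkey (groupMask n T (W + 1 - 4) g) b :=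
    gkey_eq_of_and_eq (and_eq_and_of_xor_and_eq_zero hzero)
  -- unpack the layer check on group `g`
  have hL := hlay g hg
  rw [mitmLayerOK] at hL
  simp only [Bool.and_eq_true] at hL
  obtain ⟨ht1, hprobes⟩ := hL
  -- the table pair `(i, j, a)` is found with recorded index `j`
  obtain ⟨v, hv, hvj, hvx⟩ := exists_tabFind_of_t1OK _ 0 ht1 (mem_pairXT_idxRows G 0 hij hj)
  simp only [Nat.zero_add] at hv hvj hvx
  -- the probe of `(k, l, b)` meets it
  have hprobe := probeOK_of_probesOK_four G 0 hprobes hkl hl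
  rw [Nat.zero_add] at hprobe
  rw [hkey] at hv
  have hleaf := mitmLeaf_of_probeOK hprobe hv (by rw [hvj]; exact hjk)
  rw [hvx] at hleaf
  exact allow_of_mitmLeaf hB hn hc hw hleaf

/-- **Layer 5 is sound.** Same as layer 4 with the `W − 4` groups of layer 5 and the probes `(k; l, m)` of
`probe5OK`: for all rows `i < j < k < l < m` whose XOR `c` has `popc n c ≤ W`, `c` is allow-listed. -/
theorem allow_of_mitmLayerOK_five (hsys : systematicOK n G T = true) (hG : ∀ g ∈ G, g < 2 ^ n) (hB : B ≤ 31)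
    (hn : n ≤ 8 * B) (hgrp : groupsOK n T (W + 1 - 5) = true)
    (hlay : ∀ g, g < W + 1 - 5 → mitmLayerOK n B W allow G T 5 g = true) {i j k l m : ℕ} (hij : i < j)
    (hjk : j < k) (hkl : k < l) (hlm : l < m) (hm : m < G.length)
    (hw : popc n (G[i]'(by omega) ^^^ G[j]'(by omega) ^^^ (G[k]'(by omega) ^^^ (G[l]'(by omega) ^^^ G[m]))) ≤ W) :
    allow.any (Nat.beq (G[i]'(by omega) ^^^ G[j]'(by omega) ^^^ (G[k]'(by omega) ^^^ (G[l]'(by omega) ^^^ G[m])))) =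
      true := by
  have hi : i < G.length := by omega
  have hj : j < G.length := by omega
  have hk : k < G.length := by omega
  have hl : l < G.length := by omega
  set a : ℕ := G[i] ^^^ G[j] with ha
  set b : ℕ := G[k] ^^^ (G[l] ^^^ G[m]) with hb
  have hGi : ∀ {q : ℕ} (hq : q < G.length), G[q] < 2 ^ n := fun hq => hG _ (List.getElem_mem hq)
  have hc : a ^^^ b < 2 ^ n :=
    Nat.xor_lt_two_pow (Nat.xor_lt_two_pow (hGi hi) (hGi hj))
      (Nat.xor_lt_two_pow (hGi hk) (Nat.xor_lt_two_pow (hGi hl) (hGi hm)))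
  have hred : popc n ((a ^^^ b) &&& ((2 ^ n - 1) ^^^ maskOf T)) < W + 1 - 5 := by
    have := popc_red_lt_of_popc_le (W := W) hsys hG [i, j, k, l, m]
      (by simp; omega) (by simp; omega) (by rw [xorList_map_getD_five hi hj hk hl hm]; exact hw)
    rw [xorList_map_getD_five hi hj hk hl hm] at this
    simpa using this
  obtain ⟨hAM, hAn, hdisj⟩ := groupsOK_spec hgrp
  obtain ⟨g, hg, hzero⟩ := exists_lt_and_mask_eq_zero n (W + 1 - 5) (a ^^^ b) (maskOf T)
    (groupMask n T (W + 1 - 5)) hAM hAn hdisj hred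
  have hkey : gkey (groupMask n T (W + 1 - 5) g) a = gkey (groupMask n T (W + 1 - 5) g) b :=
    gkey_eq_of_and_eq (and_eq_and_of_xor_and_eq_zero hzero)
  have hL := hlay g hg
  rw [mitmLayerOK] at hL
  simp only [Bool.and_eq_true] at hL
  obtain ⟨ht1, hprobes⟩ := hL
  obtain ⟨v, hv, hvj, hvx⟩ := exists_tabFind_of_t1OK _ 0 ht1 (mem_pairXT_idxRows G 0 hij hj)
  simp only [Nat.zero_add] at hv hvj hvx
  have hprobe := probeOK_of_probe5OK G 0 (probe5OK_of_probesOK_five hprobes) hkl hlm hm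
  rw [Nat.zero_add] at hprobe
  rw [hkey] at hv
  have hleaf := mitmLeaf_of_probeOK hprobe hv (by rw [hvj]; exact hjk)
  rw [hvx] at hleaf
  exact allow_of_mitmLeaf hB hn hc hw hleaf

/-- **Layer 3 is sound** (direct): if `direct3OK` passes on `idxRows G 0` then every XOR of rows `i < j < l` of
weight `≤ W` (words `< 2^n ≤ 2^{8B}`, `B ≤ 31`) is allow-listed. -/
theorem allow_of_direct3OK (hG : ∀ g ∈ G, g < 2 ^ n) (hB : B ≤ 31) (hn : n ≤ 8 * B)
    (h : direct3OK B W allow (idxRows G 0) = true) {i j l : ℕ} (hij : i < j) (hjl : j < l) (hl : l < G.length)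
    (hw : popc n (G[i]'(by omega) ^^^ (G[j]'(by omega) ^^^ G[l])) ≤ W) :
    allow.any (Nat.beq (G[i]'(by omega) ^^^ (G[j]'(by omega) ^^^ G[l]))) = true := by
  have hGi : ∀ {q : ℕ} (hq : q < G.length), G[q] < 2 ^ n := fun hq => hG _ (List.getElem_mem hq)
  exact allow_of_mitmLeaf hB hn (Nat.xor_lt_two_pow (hGi (by omega)) (Nat.xor_lt_two_pow (hGi (by omega)) (hGi hl)))
    hw (mitmLeaf_of_direct3OK G 0 h hij hjl hl)

/-- **Layers 1 and 2 are sound** (direct part of `mitmDirectOK`): every single row and every XOR of two rows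
`i < j` of weight `≤ W` is allow-listed; and the side conditions `t ≤ 5`, `n ≤ 8B`, `B ≤ 31`, `groupsOK` of both
group families are exposed. -/
theorem mitmDirectOK_spec {t : ℕ} (h : mitmDirectOK n B W allow G T t = true) :
    t ≤ 5 ∧ n ≤ 8 * B ∧ B ≤ 31 ∧ (∀ r ∈ idxRows G 0, mitmLeaf B W allow r.2 = true) ∧
      (∀ e ∈ pairXT (idxRows G 0), mitmLeaf B W allow e.2.2 = true) ∧
      groupsOK n T (W + 1 - 4) = true ∧ groupsOK n T (W + 1 - 5) = true := by
  simp only [mitmDirectOK, Bool.and_eq_true, Nat.ble_eq, List.all_eq_true] at h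
  obtain ⟨⟨⟨⟨⟨⟨ht, hn⟩, hB⟩, h1⟩, h2⟩, h4⟩, h5⟩ := h
  exact ⟨ht, hn, hB, h1, h2, h4, h5⟩

/-- Layer 1 from the direct part: a single row of weight `≤ W` is allow-listed. -/
theorem allow_of_mitmDirectOK_one {t : ℕ} (hG : ∀ g ∈ G, g < 2 ^ n) (h : mitmDirectOK n B W allow G T t = true)
    {i : ℕ} (hi : i < G.length) (hw : popc n G[i] ≤ W) : allow.any (Nat.beq G[i]) = true := by
  obtain ⟨-, hn, hB, h1, -⟩ := mitmDirectOK_spec h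
  have := h1 _ (mem_idxRows G 0 hi)
  exact allow_of_mitmLeaf hB hn (hG _ (List.getElem_mem hi)) hw this

/-- Layer 2 from the direct part: an XOR of two rows `i < j` of weight `≤ W` is allow-listed. -/
theorem allow_of_mitmDirectOK_two {t : ℕ} (hG : ∀ g ∈ G, g < 2 ^ n) (h : mitmDirectOK n B W allow G T t = true)
    {i j : ℕ} (hij : i < j) (hj : j < G.length) (hw : popc n (G[i]'(hij.trans hj) ^^^ G[j]) ≤ W) :
    allow.any (Nat.beq (G[i]'(hij.trans hj) ^^^ G[j])) = true := by
  obtain ⟨-, hn, hB, -, h2, -⟩ := mitmDirectOK_spec h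
  have := h2 _ (mem_pairXT_idxRows G 0 hij hj)
  exact allow_of_mitmLeaf hB hn
    (Nat.xor_lt_two_pow (hG _ (List.getElem_mem (hij.trans hj))) (hG _ (List.getElem_mem hj))) hw this

end Layers

end Summit.Ventures.QEC.Census
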